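import Literature.Geometry.Lorentzian.MassCapacitySchwarzschildEnd
import HarnessLib

/-!
# An exterior region isometric to the Schwarzschild exterior is an end of the manifold, and its
# horizon has capacity `2m` (Bray 2001, Thm. 9, case of equality, for the conclusion of Thm. 19)

The rigidity statements of the tree conclude with an **isometry** `Φ : U ≅ {m/2 < ‖y‖}` of an
exterior region `U ⊆ X` of the data manifold `(X, h)` onto the Schwarzschild exterior,
`Φ^* ((1 + m/2‖y‖)⁴ δ) = h` on `U` (`Bray2001_penrose_rigidity_exteriorRegion`,
`Bray2001_capacity_rigidity`), while the quantities attached to the end `e` of `X` — functions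
"going to one at infinity", the capacity `ℰ(∂U, h)` of Def. 17 (`horizonCapacity D.h e U`) —
are read in the given chart of `e`. This file proves that such a `Φ` is itself an end
structure of `X` on `U` describing **the same end** as `e` (Bartnik's "two structures of
infinity", `AFEnd.IsSameEnd`), so that everything read at infinity may be read through `Φ`, and
deduces `ℰ(∂U, h) = 2m` from `MassCapacitySchwarzschildEnd.lean`:

* `AFEnd.tendstoAtEnd_iff_far`, `AFEnd.IsSameEnd.tendstoAtEnd_iff`,
  `AFEnd.IsSameEnd.isCapacityTestFn_iff`, `AFEnd.IsSameEnd.horizonCapacity_eq`,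
  `AFEnd.IsSameEnd.isExteriorRegion` — limits at infinity, test functions, the capacity and
  exterior regions depend only on the end, not on the end structure.
* `AFEnd.exists_radius_half_le_sqrt_det_hCoeff` — on an end asymptotically flat of order
  `α > 0` in the metric, `√(det h_{ij}) ≥ 1/2` far out.
* `not_far_subset_normLt` — **the far regions of `e` are not mapped near the
  horizon**: no far region `e.far R₁ ⊆ U` is contained in `{‖Φ‖ < R'}`. (Volume: in the chart of
  `e` the map `T = Φ ∘ Φ_e` is injective and `C¹` with `√(det h_{ij}) = ψ(T)⁶ |det DT|`, so
  `|det DT| ≥ 1/128` far out and `T` maps a region of infinite Lebesgue measure into the ball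
  `‖y‖ < R'` — the change of variables `Leb(T(A)) = ∫_A |det DT|`.)
* `exists_far_subset_normGt`, `exists_normGt_subset_far` — hence, by connectedness of the far
  regions of both structures, the two families of far regions are cofinal in each other;
  `isClosed_val_image_preimage_normGe` — and `{R' ≤ ‖Φ‖}` is closed in `X` for `R' > m/2` (the
  end structure `Φ` is closed at infinity).
* `exists_afEnd_isSameEnd` — **main structural theorem**: there is an end structure
  `e'` of `X` with `e'.U = U`, inner radius `m/2`, `IsSameEnd e e'`, and Schwarzschild chart
  components `h_{ij} = (1 + m/2‖z‖)⁴ δ_{ij}`.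
* `horizonCapacity_eq_of_diffeomorph_schwarzschild` — **`ℰ(∂U, h) = 2m`**:
  `horizonCapacity D.h e U = ENNReal.ofReal (4a)`, `a = m/2`
  (`AFEnd.horizonCapacity_eq_of_hCoeff_eq_schwarzschild` for `e'`, transported by `IsSameEnd`);
  with `horizonCapacity_toReal_div_two_eq_of_diffeomorph_schwarzschild` (`ℰ/2 = m`) this is the
  passage from the conclusion of `Bray2001_penrose_rigidity_exteriorRegion` to that of
  `Bray2001_capacity_eq_of_penrose_eq`.

Everything is proved; no definitions and no named facts are introduced.

## References

* H. L. Bray, *Proof of the Riemannian Penrose inequality using the positive mass theorem*,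
  J. Differential Geom. 59 (2001) 177–267 (arXiv:math/9911173): §1 (12); §6 Def. 17, Thm. 9
  (case of equality); §13 Thm. 19. (key `BrayRPI2001`)
* R. Bartnik, *The mass of an asymptotically flat manifold*, CPAM 39 (1986), §1 and §3
  (structures of infinity of the same end). (key `Bartnik1986`)
-/

noncomputable section

open Set Filter Function MeasureTheory Metric Topology TopologicalSpace Manifold Bundle Bornology
open scoped ENNReal Topology Real Manifold ContDiff InnerProductSpace

namespace Literature.Geometry.Lorentzian

open PseudoRiemannianMetric SchwarzschildCapacity

/-! ### Euclidean preliminaries -/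

/-- The exterior `{ρ < ‖z‖}` of a closed ball, as a subset of the exterior region `{r < ‖z‖}`
(`r ≤ ρ`, `0 ≤ ρ`), is preconnected. [folklore] -/
theorem isPreconnected_exteriorRegion_normGt {r ρ : ℝ} (hρ : 0 ≤ ρ) (hrρ : r ≤ ρ) :
    IsPreconnected {y : exteriorRegion r | ρ < ‖(y : E3)‖} := by
  refine (Topology.IsInducing.subtypeVal.isPreconnected_image).1 ?_
  convert (isPathConnected_compl_closedBall hρ).isConnected.isPreconnected using 1
  ext z
  simp only [mem_image, mem_compl_iff, mem_closedBall, dist_zero_right, not_le]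
  constructor
  · rintro ⟨y, hy, rfl⟩
    exact hy
  · intro hz
    exact ⟨⟨z, mem_exteriorRegion.2 (hrρ.trans_lt hz)⟩, hz, rfl⟩

/-- The exterior of a closed ball in `ℝ³` has infinite Lebesgue measure. [folklore] -/
theorem volume_compl_closedBall_eq_top (ρ : ℝ) : volume (closedBall (0 : E3) ρ)ᶜ = ⊤ := by
  have h := measure_add_measure_compl (μ := (volume : Measure E3))
    (measurableSet_closedBall (x := (0 : E3)) (ε := ρ))
  rw [measure_univ_of_isAddLeftInvariant] at h
  exact (ENNReal.add_eq_top.1 h).resolve_left (measure_closedBall_lt_top (x := (0 : E3))).ne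

/-- The Gram matrix of `c • ⟨·, ·⟩` in the standard basis of `ℝ³` is `c • 1`. [folklore] -/
theorem matrix_of_smul_inner_single (c : ℝ) :
    (Matrix.of fun i j : Fin 3 ↦ c * ⟪(EuclideanSpace.single i (1 : ℝ) : E3),
      EuclideanSpace.single j (1 : ℝ)⟫_ℝ) = c • (1 : Matrix (Fin 3) (Fin 3) ℝ) := by
  ext i j
  rw [Matrix.of_apply, Matrix.smul_apply, Matrix.one_apply, smul_eq_mul,
    orthonormal_iff_ite.1 (EuclideanSpace.orthonormal_single (𝕜 := ℝ) (ι := Fin 3)) i j]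

namespace AFEnd

variable {X : Type} [TopologicalSpace X] [ChartedSpace E3 X]

/-! ### Limits at infinity and the capacity depend only on the end -/

section SameEnd

variable (e : AFEnd X)

/-- **`φ → c` at infinity iff `φ` is `ε`-close to `c` on far regions**: `TendstoAtEnd e φ c`
(convergence of `φ ∘ Φ` along the cobounded filter of the chart) holds iff for every `ε > 0`
there is a far region `e.far R'` on which `dist (φ x) c < ε`. [folklore] -/
theorem tendstoAtEnd_iff_far {φ : X → ℝ} {c : ℝ} :
    TendstoAtEnd e φ c ↔ ∀ ε > 0, ∃ R', ∀ x ∈ e.far R', dist (φ x) c < ε := by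
  constructor
  · intro hφ ε hε
    obtain ⟨r, hr⟩ := exists_radius_of_eventually (Metric.tendsto_nhds.1 hφ ε hε)
    refine ⟨max r e.R, fun x hx ↦ ?_⟩
    obtain ⟨z, hz, rfl⟩ := e.mem_far_iff.1 hx
    have h1 := hr z ((le_max_left _ _).trans hz.le)
    rwa [endValue_of_lt e φ z.2] at h1
  · intro h
    refine Metric.tendsto_nhds.2 fun ε hε ↦ ?_
    obtain ⟨R', hR'⟩ := h ε hε
    filter_upwards [eventually_cobounded_le_norm (E := E3) (max R' e.R + 1)] with z hz
    have hz' : e.R < ‖z‖ := by linarith [le_max_right R' e.R]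
    rw [endValue_of_lt e φ hz']
    exact hR' _ (e.mem_far_iff.2 ⟨⟨z, hz'⟩, by
      show R' < ‖z‖
      linarith [le_max_left R' e.R], rfl⟩)

variable {e} {e' : AFEnd X}

/-- **Limits at infinity depend only on the end**: if `e`, `e'` describe the same end
(`IsSameEnd`), then `φ → c` at infinity in `e` iff in `e'`. Bartnik 1986, §3.
[cite: Bartnik1986, §3] -/
theorem IsSameEnd.tendstoAtEnd_iff (h : IsSameEnd e e') {φ : X → ℝ} {c : ℝ} :
    TendstoAtEnd e φ c ↔ TendstoAtEnd e' φ c := by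
  rw [e.tendstoAtEnd_iff_far, e'.tendstoAtEnd_iff_far]
  constructor
  · intro hφ ε hε
    obtain ⟨R', hR'⟩ := hφ ε hε
    obtain ⟨R₁, hR₁⟩ := h.2 R'
    exact ⟨R₁, fun x hx ↦ hR' x (hR₁ hx)⟩
  · intro hφ ε hε
    obtain ⟨R', hR'⟩ := hφ ε hε
    obtain ⟨R₁, hR₁⟩ := h.1 R'
    exact ⟨R₁, fun x hx ↦ hR' x (hR₁ hx)⟩

/-- **Test functions of the capacity depend only on the end.** [cite: BrayRPI2001, §6 Def. 17] -/
theorem IsSameEnd.isCapacityTestFn_iff (h : IsSameEnd e e') {U : Opens X} {φ : X → ℝ} :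
    IsCapacityTestFn e U φ ↔ IsCapacityTestFn e' U φ :=
  ⟨fun ⟨h1, h2, h3, h4⟩ ↦ ⟨h1, h2, h3, h.tendstoAtEnd_iff.1 h4⟩,
    fun ⟨h1, h2, h3, h4⟩ ↦ ⟨h1, h2, h3, h.tendstoAtEnd_iff.2 h4⟩⟩

/-- **The capacity `ℰ(Σ, g)` depends only on the end**, not on the end structure in which
"`φ → 1` at infinity" is read. Bray 2001, §6, Def. 17. [cite: BrayRPI2001, §6 Def. 17] -/
theorem IsSameEnd.horizonCapacity_eq [IsManifold (𝓡 3) ∞ X] [T2Space X] [LocallyCompactSpace X]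
    [MeasurableSpace X] [BorelSpace X]
    (hm : ContMDiffRiemannianMetric (𝓡 3) ∞ E3 (TangentSpace (𝓡 3) : X → Type _))
    (h : IsSameEnd e e') (U : Opens X) :
    horizonCapacity hm e U = horizonCapacity hm e' U :=
  iInf_congr fun _ ↦ iInf_congr_Prop h.isCapacityTestFn_iff fun _ ↦ rfl

/-- **Exterior regions depend only on the end**: if `U` is the exterior region of `e` and `e'`
describes the same end, then `U` is the exterior region of `e'` (far regions of `e'` inside
`U`, and `closure U` compact modulo them, by cofinality and
`IsExteriorRegion.isCompact_closure_diff_far`). [folklore] -/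
theorem IsSameEnd.isExteriorRegion (h : IsSameEnd e e') {U : Opens X} (hU : IsExteriorRegion e U) :
    IsExteriorRegion e' U := by
  obtain ⟨hconn, R₀, -, hfar, -⟩ := id hU
  obtain ⟨R₁, hR₁⟩ := h.2 R₀
  set R₁' := max R₁ (e'.R + 1) with hR₁'
  obtain ⟨R₂, hR₂⟩ := h.1 R₁'
  refine ⟨hconn, R₁', by simp [hR₁'], ((e'.far_mono (le_max_left _ _)).trans hR₁).trans hfar, ?_⟩
  exact (hU.isCompact_closure_diff_far R₂).of_isClosed_subset
    (isClosed_closure.sdiff (e'.isOpen_far _)) fun x hx ↦ ⟨hx.1, fun hx' ↦ hx.2 (hR₂ hx')⟩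

end SameEnd

/-! ### Compact sets avoid far regions; far regions are preconnected -/

section FarTopology

variable (e : AFEnd X)

/-- **A compact set misses all sufficiently far regions** (the end is closed at infinity: the
closed far pieces `{R ≤ ‖coord‖}` decrease to `∅`). [cite: Bartnik1986, §1] -/
theorem exists_radius_far_disjoint {S : Set X} (hS : IsCompact S) :
    ∃ R₁, e.R < R₁ ∧ ∀ R, R₁ ≤ R → Disjoint (e.far R) S := by
  -- the increasing open cover by complements of closed far pieces
  set V : ℕ → Set X := fun n ↦ (((↑) : e.U → X) '' (e.chart ⁻¹' {z | e.R + n + 1 ≤ ‖(z : E3)‖}))ᶜ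
    with hV
  have hVo : ∀ n, IsOpen (V n) := fun n ↦
    (e.isClosed_far (e.R + n + 1) (by linarith [n.cast_nonneg (α := ℝ)])).isOpen_compl
  have hcov : S ⊆ ⋃ n, V n := by
    intro x _
    by_cases hx : x ∈ e.U
    · obtain ⟨n, hn⟩ := exists_nat_gt (‖e.coord x‖ - e.R - 1)
      refine mem_iUnion.2 ⟨n, fun h ↦ ?_⟩
      obtain ⟨-, h2⟩ := e.mem_image_preimage_le_norm_iff.1 h
      linarith
    · refine mem_iUnion.2 ⟨0, fun h ↦ hx ?_⟩
      exact (e.mem_image_preimage_le_norm_iff.1 h).1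
  have hdir : Directed (· ⊆ ·) V := by
    refine Monotone.directed_le fun m n hmn x hx h ↦ hx ?_
    obtain ⟨hxU, h2⟩ := e.mem_image_preimage_le_norm_iff.1 h
    exact e.mem_image_preimage_le_norm_iff.2 ⟨hxU, by
      have : (m : ℝ) ≤ n := Nat.cast_le.2 hmn
      linarith⟩
  obtain ⟨N, hN⟩ := hS.elim_directed_cover V hVo hcov hdir
  refine ⟨e.R + N + 1, by linarith [N.cast_nonneg (α := ℝ)], fun R hR ↦ ?_⟩
  refine Set.disjoint_left.2 fun x hx hxS ↦ hN hxS ?_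
  obtain ⟨hxU, h2⟩ := e.mem_far_iff_coord.1 hx
  exact e.mem_image_preimage_le_norm_iff.2 ⟨hxU, by linarith⟩

/-- **Far regions are preconnected** (`R ≤ R₁`: the image of the exterior of a ball under the
chart). [folklore] -/
theorem isPreconnected_far {R₁ : ℝ} (hR₁ : e.R ≤ R₁) : IsPreconnected (e.far R₁) := by
  have h : e.far R₁ = e.dataChart '' {y : exteriorRegion e.R | R₁ < ‖(y : E3)‖} := by
    ext x
    rw [e.mem_far_iff]
    constructor
    · rintro ⟨z, hz, rfl⟩
      exact ⟨z, hz, rfl⟩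
    · rintro ⟨z, hz, rfl⟩
      exact ⟨z, hz, rfl⟩
  rw [h]
  exact (isPreconnected_exteriorRegion_normGt (e.R_pos.le.trans hR₁) hR₁).image _
    e.contMDiff_dataChart.continuous.continuousOn

/-- The closed far piece `{x ∈ e.U | R₁ ≤ ‖coord x‖}` lies in every far region of smaller radius.
[folklore] -/
theorem image_preimage_normGe_subset_far {R₀ R₁ : ℝ} (h : R₀ < R₁) :
    ((↑) : e.U → X) '' (e.chart ⁻¹' {z | R₁ ≤ ‖(z : E3)‖}) ⊆ e.far R₀ := by
  intro x hx
  obtain ⟨hxU, h2⟩ := e.mem_image_preimage_le_norm_iff.1 hx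
  exact e.mem_far_iff_coord.2 ⟨hxU, h.trans_le h2⟩

/-- The closure of a far region lies in the closed far piece of the same radius (`R < R₁`).
[folklore] -/
theorem closure_far_subset {R₁ : ℝ} (hR₁ : e.R < R₁) :
    closure (e.far R₁) ⊆ ((↑) : e.U → X) '' (e.chart ⁻¹' {z | R₁ ≤ ‖(z : E3)‖}) := by
  refine closure_minimal (fun x hx ↦ ?_) (e.isClosed_far R₁ hR₁)
  obtain ⟨hxU, h2⟩ := e.mem_far_iff_coord.1 hx
  exact e.mem_image_preimage_le_norm_iff.2 ⟨hxU, h2.le⟩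

end FarTopology

/-! ### The volume density of an asymptotically flat end is bounded below far out -/

section Density

variable [IsManifold (𝓡 3) ∞ X] (e : AFEnd X) (D : InitialDataSet (𝓡 3) X)

set_option synthInstance.maxHeartbeats 200000 in
/-- **`√(det h_{ij}) ≥ 1/2` far out** on an end asymptotically flat of order `α > 0` in the
metric: `h_{ij}(z) → δ_{ij}` entrywise, so `det h_{ij}(z) → 1` (continuity of the determinant).
[folklore] -/
theorem exists_radius_half_le_sqrt_det_hCoeff {α : ℝ} (hα : 0 < α)
    (hAF : e.IsMetricAsymptoticallyFlat D α) :
    ∃ R₃ : ℝ, ∀ z : E3, R₃ ≤ ‖z‖ → (1 : ℝ) / 2 ≤ Real.sqrt (Matrix.of fun i j ↦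
      hCoeff e D z (EuclideanSpace.single i 1) (EuclideanSpace.single j 1)).det := by
  set M : E3 → Matrix (Fin 3) (Fin 3) ℝ := fun z ↦ Matrix.of fun i j ↦
    hCoeff e D z (EuclideanSpace.single i 1) (EuclideanSpace.single j 1) with hM
  -- `‖h(z) - δ‖ → 0`
  obtain ⟨c₀, hc₀, h0⟩ := (hAF 0 (by norm_num)).exists_pos
  have hnorm : Tendsto (fun z : E3 ↦ ‖hCoeff e D z - (innerSL ℝ : E3 →L[ℝ] E3 →L[ℝ] ℝ)‖)
      (cobounded E3) (𝓝 0) := by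
    have ht : Tendsto (fun x : E3 ↦ c₀ * ‖x‖ ^ (-α)) (cobounded E3) (𝓝 0) := by
      rw [← mul_zero c₀]
      exact ((tendsto_rpow_neg_atTop hα).comp tendsto_norm_cobounded_atTop).const_mul c₀
    refine squeeze_zero' (Eventually.of_forall fun z ↦
      norm_nonneg (hCoeff e D z - (innerSL ℝ : E3 →L[ℝ] E3 →L[ℝ] ℝ))) ?_ ht
    filter_upwards [h0.bound, eventually_cobounded_le_norm (E := E3) 1] with x hx0 hx1
    have hxpos : 0 < ‖x‖ := by linarith
    rw [norm_norm, norm_iteratedFDeriv_zero, Real.norm_of_nonneg (Real.rpow_nonneg hxpos.le _)]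
      at hx0
    simpa using hx0
  -- hence `M z → 1` entrywise and `det (M z) → 1`
  have hM1 : Tendsto M (cobounded E3) (𝓝 1) := by
    refine tendsto_pi_nhds.2 fun i ↦ tendsto_pi_nhds.2 fun j ↦ ?_
    have hij : (1 : Matrix (Fin 3) (Fin 3) ℝ) i j =
        (innerSL ℝ : E3 →L[ℝ] E3 →L[ℝ] ℝ) (EuclideanSpace.single i 1)
          (EuclideanSpace.single j 1) := by
      rw [innerSL_apply_apply, Matrix.one_apply,
        orthonormal_iff_ite.1 (EuclideanSpace.orthonormal_single (𝕜 := ℝ) (ι := Fin 3)) i j]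
    rw [hij, tendsto_iff_norm_sub_tendsto_zero]
    refine squeeze_zero (fun z ↦ norm_nonneg _) (fun z ↦ ?_) hnorm
    have h := (hCoeff e D z - (innerSL ℝ : E3 →L[ℝ] E3 →L[ℝ] ℝ)).le_opNorm₂
      (EuclideanSpace.single i (1 : ℝ)) (EuclideanSpace.single j (1 : ℝ))
    have hs : ∀ k : Fin 3, ‖(EuclideanSpace.single k (1 : ℝ) : E3)‖ = 1 := fun k ↦ by simp
    rw [hs, hs, mul_one, mul_one, sub_apply, sub_apply] at h
    exact h
  have hdet : Tendsto (fun z ↦ (M z).det) (cobounded E3) (𝓝 1) := by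
    have h := ((continuous_id.matrix_det).tendsto (1 : Matrix (Fin 3) (Fin 3) ℝ)).comp hM1
    rwa [id_eq, Matrix.det_one] at h
  obtain ⟨R₃, hR₃⟩ := exists_radius_of_eventually
    (hdet.eventually (Ici_mem_nhds (show (1 : ℝ) / 4 < 1 by norm_num)))
  refine ⟨R₃, fun z hz ↦ ?_⟩
  rw [Real.le_sqrt' (by norm_num)]
  have h : (1 : ℝ) / 4 ≤ (M z).det := hR₃ z hz
  nlinarith

end Density

end AFEnd

/-! ### An isometry of an exterior region onto the Schwarzschild exterior -/

section Isometry

variable {X : Type} [TopologicalSpace X] [ChartedSpace E3 X] {U : Opens X} {a : ℝ}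
  (Φ : Diffeomorph (𝓡 3) (𝓡 3) U (exteriorRegion a) ∞)

/-- The part of `U` mapped by `Φ` into a compact subset of `{a < ‖y‖}` is compact in `X`.
[folklore] -/
theorem isCompact_val_image_preimage {K : Set E3} (hK : IsCompact K) (hKa : K ⊆ {z | a < ‖z‖}) :
    IsCompact (((↑) : U → X) '' (Φ ⁻¹' {y | (y : E3) ∈ K})) := by
  refine IsCompact.image ?_ continuous_subtype_val
  have h1 : IsCompact {y : exteriorRegion a | (y : E3) ∈ K} := by
    rw [Topology.IsEmbedding.subtypeVal.isCompact_iff]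
    convert hK using 1
    ext z
    constructor
    · rintro ⟨y, hy, rfl⟩
      exact hy
    · intro hz
      exact ⟨⟨z, mem_exteriorRegion.2 (hKa hz)⟩, hz, rfl⟩
  have h2 := (Φ.toHomeomorph.isCompact_preimage (s := {y : exteriorRegion a | (y : E3) ∈ K})).2 h1
  rwa [Diffeomorph.coe_toHomeomorph] at h2

/-- `{R' < ‖Φ‖}` is open in `X`. [folklore] -/
theorem isOpen_val_image_preimage_normGt (R' : ℝ) :
    IsOpen (((↑) : U → X) '' (Φ ⁻¹' {y | R' < ‖(y : E3)‖})) :=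
  U.isOpen.isOpenMap_subtype_val _
    ((isOpen_lt continuous_const continuous_subtype_val.norm).preimage Φ.continuous)

/-- `{‖Φ‖ < R'}` is open in `X`. [folklore] -/
theorem isOpen_val_image_preimage_normLt (R' : ℝ) :
    IsOpen (((↑) : U → X) '' (Φ ⁻¹' {y | ‖(y : E3)‖ < R'})) :=
  U.isOpen.isOpenMap_subtype_val _
    ((isOpen_lt continuous_subtype_val.norm continuous_const).preimage Φ.continuous)

/-- `{R' < ‖Φ‖}` is preconnected for `a ≤ R'` (`0 < a`): the preimage of the exterior of a ball
under the diffeomorphism. [folklore] -/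
theorem isPreconnected_val_image_preimage_normGt (ha : 0 < a) {R' : ℝ} (hR' : a ≤ R') :
    IsPreconnected (((↑) : U → X) '' (Φ ⁻¹' {y | R' < ‖(y : E3)‖})) := by
  refine IsPreconnected.image ?_ _ continuous_subtype_val.continuousOn
  have h : Φ ⁻¹' {y : exteriorRegion a | R' < ‖(y : E3)‖} =
      Φ.symm '' {y : exteriorRegion a | R' < ‖(y : E3)‖} := by
    ext x
    constructor
    · intro hx
      exact ⟨Φ x, hx, Φ.symm_apply_apply x⟩
    · rintro ⟨y, hy, rfl⟩
      show Φ (Φ.symm y) ∈ {y : exteriorRegion a | R' < ‖(y : E3)‖}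
      rw [Φ.apply_symm_apply]
      exact hy
  rw [h]
  exact (isPreconnected_exteriorRegion_normGt (ha.le.trans hR') hR').image _
    Φ.symm.continuous.continuousOn

variable [IsManifold (𝓡 3) ∞ X] {e : AFEnd X} {D : InitialDataSet (𝓡 3) X}

/-- **The far regions of the end are not mapped near the horizon.** Let
`Φ : U ≅ {a < ‖y‖}` pull the Schwarzschild metric `(1 + a/‖y‖)⁴ δ` back to `h` on `U`, and let
the end `e` be asymptotically flat of some order `α > 0` in the metric. Then no far region
`e.far R₁ ⊆ U` (`R < R₁`) is contained in `{‖Φ‖ < R'}`. Proof by volume: in the chart of `e`,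
`T = Φ ∘ Φ_e` is injective and differentiable on `{R₁ < ‖z‖}` with
`√(det h_{ij}(z)) = |det DT(z)| (1 + a/‖T z‖)⁶`, so `|det DT| ≥ 1/128` far out
(`√(det h_{ij}) ≥ 1/2`, `1 + a/‖T z‖ ≤ 2`), and by the change of variables
`Leb(T(A)) = ∫_A |det DT|` (Mathlib's `lintegral_abs_det_fderiv_eq_addHaar_image`) the image of the
exterior of a large ball would have infinite Lebesgue measure inside the ball `‖y‖ < R'`.
[cite: Bartnik1986, §3 (structures of infinity of the same end)] -/
theorem not_far_subset_normLt (ha : 0 < a) {α : ℝ} (hα : 0 < α)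
    (hAF : e.IsMetricAsymptoticallyFlat D α)
    (hΦ : ∀ x : U, pullbackBilin (I := 𝓡 3) (I' := 𝓡 3) Φ
      (fun y ↦ (1 + a / ‖(y : E3)‖) ^ 4 • (innerSL ℝ (E := E3) : E3 →L[ℝ] E3 →L[ℝ] ℝ)) x =
        D.metric.val x.1)
    {R₁ : ℝ} (hR₁ : e.R < R₁) (hfarU : e.far R₁ ⊆ (U : Set X)) (R' : ℝ) :
    ¬ e.far R₁ ⊆ ((↑) : U → X) '' (Φ ⁻¹' {y | ‖(y : E3)‖ < R'}) := by
  classical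
  intro hsub
  -- the global coordinate function of `Φ`
  set Ψ : X → E3 := fun x ↦ if hx : x ∈ (U : Set X) then (Φ ⟨x, hx⟩ : E3) else 0 with hΨ_def
  have hΨU : ∀ x : U, Ψ x = (Φ x : E3) := fun x ↦ by
    rw [hΨ_def]
    dsimp only
    rw [dif_pos (show (x : X) ∈ (U : Set X) from x.2)]
  have hΨa : ∀ x : U, a < ‖Ψ x‖ := fun x ↦ by
    rw [hΨU]
    exact mem_exteriorRegion.1 (Φ x).2
  -- `Ψ` is smooth on `U`, with the differential of `Φ`
  have hΨs : ContMDiff (𝓡 3) 𝓘(ℝ, E3) ∞ (fun x : U ↦ Ψ x) := by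
    have : (fun x : U ↦ Ψ x) = fun x ↦ ((Φ x : exteriorRegion a) : E3) := funext hΨU
    rw [this]
    exact contMDiff_subtype_val.comp Φ.contMDiff
  have hΨd : ∀ x : U, MDifferentiableAt (𝓡 3) 𝓘(ℝ, E3) Ψ (x : X) := fun x ↦
    (contMDiffAt_subtype_iff.1 (hΨs x)).mdifferentiableAt (by simp)
  have hΨmf : ∀ (x : U) (v : E3), mfderiv (𝓡 3) 𝓘(ℝ, E3) Ψ (x : X) v =
      (mfderiv (𝓡 3) (𝓡 3) Φ x v : E3) := by
    intro x v
    rw [← mfderiv_comp_subtypeVal (hΨd x)]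
    have hc : MDifferentiableAt (𝓡 3) (𝓡 3) Φ x := Φ.contMDiff.mdifferentiableAt (by simp)
    have h1 : (Ψ ∘ Subtype.val : U → E3) = (Subtype.val : exteriorRegion a → E3) ∘ Φ :=
      funext hΨU
    rw [h1, mfderiv_comp x (hasMFDerivAt_subtypeVal (Φ x)).mdifferentiableAt hc,
      mfderiv_subtypeVal]
    rfl
  -- the metric of `X` on `U` through `Ψ`: `h_p(v, w) = ψ(Ψ p)⁴ ⟪dΨ_p v, dΨ_p w⟫`
  have hmet : ∀ (p : X) (hp : p ∈ (U : Set X)) (v w : E3), D.h.inner p v w =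
      (1 + a / ‖Ψ p‖) ^ 4 *
        @inner ℝ E3 _ (mfderiv (𝓡 3) 𝓘(ℝ, E3) Ψ p v) (mfderiv (𝓡 3) 𝓘(ℝ, E3) Ψ p w) := by
    intro p hp v w
    have h := DFunLike.congr_fun (DFunLike.congr_fun (hΦ ⟨p, hp⟩) v) w
    have h' : (1 + a / ‖(Φ ⟨p, hp⟩ : E3)‖) ^ 4 *
        @inner ℝ E3 _ (mfderiv (𝓡 3) (𝓡 3) Φ ⟨p, hp⟩ v) (mfderiv (𝓡 3) (𝓡 3) Φ ⟨p, hp⟩ w) =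
          D.h.inner p v w := h
    rw [← hΨU ⟨p, hp⟩] at h'
    rw [hΨmf ⟨p, hp⟩, hΨmf ⟨p, hp⟩]
    exact h'.symm
  -- the transition map `T = Ψ ∘ Φ_e` on `O = {R₁ < ‖z‖}` and its differential
  set T : E3 → E3 := Ψ ∘ e.dataChartExt with hT
  set T' : E3 → E3 →L[ℝ] E3 := fun z ↦ (mfderiv (𝓡 3) 𝓘(ℝ, E3) Ψ (e.dataChartExt z)).comp
    (mfderiv 𝓘(ℝ, E3) (𝓡 3) e.dataChartExt z) with hT'
  set O : Set E3 := {z | R₁ < ‖z‖} with hO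
  have hmemfar : ∀ z ∈ O, e.dataChartExt z ∈ e.far R₁ := fun z hz ↦ by
    rw [e.dataChartExt_of_lt (hR₁.trans hz)]
    exact e.mem_far_iff.2 ⟨⟨z, hR₁.trans hz⟩, hz, rfl⟩
  have hmemU : ∀ z ∈ O, e.dataChartExt z ∈ (U : Set X) := fun z hz ↦ hfarU (hmemfar z hz)
  have hTd : ∀ z ∈ O, HasFDerivAt T (T' z) z := by
    intro z hz
    have h1 : HasMFDerivAt 𝓘(ℝ, E3) (𝓡 3) e.dataChartExt z
        (mfderiv 𝓘(ℝ, E3) (𝓡 3) e.dataChartExt z) :=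
      ((e.contMDiffAt_dataChartExt (hR₁.trans hz)).mdifferentiableAt (by simp)).hasMFDerivAt
    have h2 : HasMFDerivAt (𝓡 3) 𝓘(ℝ, E3) Ψ (e.dataChartExt z)
        (mfderiv (𝓡 3) 𝓘(ℝ, E3) Ψ (e.dataChartExt z)) :=
      (hΨd ⟨e.dataChartExt z, hmemU z hz⟩).hasMFDerivAt
    exact hasMFDerivAt_iff_hasFDerivAt.1 (h2.comp z h1)
  have hTinj : InjOn T O := by
    intro z₁ h₁ z₂ h₂ heq
    have hΦeq : Φ ⟨e.dataChartExt z₁, hmemU z₁ h₁⟩ = Φ ⟨e.dataChartExt z₂, hmemU z₂ h₂⟩ := by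
      apply Subtype.ext
      show (Φ ⟨e.dataChartExt z₁, hmemU z₁ h₁⟩ : E3) = (Φ ⟨e.dataChartExt z₂, hmemU z₂ h₂⟩ : E3)
      rw [← hΨU, ← hΨU]
      exact heq
    have hx := Φ.injective hΦeq
    exact e.injOn_dataChartExt (hR₁.trans h₁) (hR₁.trans h₂) (congrArg Subtype.val hx)
  -- `h_{ij}(z) = ψ(T z)⁴ ⟪T' v, T' w⟫` and the Gram determinant
  have hco : ∀ z ∈ O, ∀ v w : E3,
      AFEnd.hCoeff e D z v w = (1 + a / ‖T z‖) ^ 4 * ⟪T' z v, T' z w⟫_ℝ := by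
    intro z hz v w
    have hz' : e.R < ‖z‖ := hR₁.trans hz
    have hp : e.dataChart ⟨z, hz'⟩ ∈ (U : Set X) := by
      rw [← e.dataChartExt_of_lt hz']
      exact hmemU z hz
    rw [AFEnd.hCoeff_of_lt D hz']
    show D.h.inner (e.dataChart ⟨z, hz'⟩) (mfderiv (𝓡 3) (𝓡 3) e.dataChart ⟨z, hz'⟩ v)
      (mfderiv (𝓡 3) (𝓡 3) e.dataChart ⟨z, hz'⟩ w) = _
    rw [e.mfderiv_dataChart_eq, e.mfderiv_dataChart_eq, hmet _ hp, ← e.dataChartExt_of_lt hz']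
    rfl
  have hgram : ∀ z ∈ O, Real.sqrt (Matrix.of fun i j ↦ AFEnd.hCoeff e D z
      (EuclideanSpace.single i 1) (EuclideanSpace.single j 1)).det =
      |(T' z).det| * (1 + a / ‖T z‖) ^ 6 := by
    intro z hz
    set c : ℝ := (1 + a / ‖T z‖) ^ 4 with hc
    set b : Module.Basis (Fin 3) ℝ E3 := (EuclideanSpace.basisFun (Fin 3) ℝ).toBasis with hb
    have hbi : ∀ i, b i = EuclideanSpace.single i 1 := fun i ↦ by
      rw [hb, OrthonormalBasis.coe_toBasis, EuclideanSpace.basisFun_apply]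
    set B : LinearMap.BilinForm ℝ E3 := c • innerₗ E3 with hB
    have hBapp : ∀ v w : E3, B v w = c * ⟪v, w⟫_ℝ := fun v w ↦ by
      rw [hB, LinearMap.smul_apply, LinearMap.smul_apply, innerₗ_apply_apply, smul_eq_mul]
    have h1 : (Matrix.of fun i j ↦ AFEnd.hCoeff e D z (EuclideanSpace.single i 1)
        (EuclideanSpace.single j 1)) =
        Matrix.of fun i j ↦ B ((T' z : E3 →ₗ[ℝ] E3) (b i)) ((T' z : E3 →ₗ[ℝ] E3) (b j)) := by
      ext i j
      rw [Matrix.of_apply, Matrix.of_apply, hBapp, hco z hz, hbi, hbi]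
      rfl
    have h2 : (Matrix.of fun i j ↦ B (b i) (b j)) = c • (1 : Matrix (Fin 3) (Fin 3) ℝ) := by
      rw [← matrix_of_smul_inner_single c]
      ext i j
      rw [Matrix.of_apply, Matrix.of_apply, hBapp, hbi, hbi]
    have hψ0 : 0 ≤ 1 + a / ‖T z‖ := by positivity
    rw [h1, sqrt_det_gram_comp b B, h2, Matrix.det_smul, Matrix.det_one, mul_one, Fintype.card_fin,
      hc, show ((1 + a / ‖T z‖) ^ 4) ^ 3 = ((1 + a / ‖T z‖) ^ 6) ^ 2 by ring,
      Real.sqrt_sq (by positivity)]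
  -- the Jacobian is bounded below far out
  obtain ⟨R₃, hR₃⟩ := e.exists_radius_half_le_sqrt_det_hCoeff D hα hAF
  have hjac : ∀ z ∈ O, R₃ ≤ ‖z‖ → (1 : ℝ) / 128 ≤ |(T' z).det| := by
    intro z hz hz3
    have h1 := hR₃ z hz3
    rw [hgram z hz] at h1
    have hTa : a < ‖T z‖ := hΨa ⟨e.dataChartExt z, hmemU z hz⟩
    have hq : a / ‖T z‖ ≤ 1 := (div_le_one (ha.trans hTa)).2 hTa.le
    have hq0 : 0 ≤ a / ‖T z‖ := by positivity
    have hψ : (1 + a / ‖T z‖) ^ 6 ≤ 2 ^ 6 := pow_le_pow_left₀ (by positivity) (by linarith) 6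
    nlinarith [abs_nonneg ((T' z).det)]
  -- change of variables on `O' = {max R₁ R₃ < ‖z‖}`
  set O' : Set E3 := {z | max R₁ R₃ < ‖z‖} with hO'
  have hO'O : O' ⊆ O := fun z hz ↦
    show R₁ < ‖z‖ from (le_max_left R₁ R₃).trans_lt (show max R₁ R₃ < ‖z‖ from hz)
  have hO'm : MeasurableSet O' := (isOpen_lt continuous_const continuous_norm).measurableSet
  have hcov := lintegral_abs_det_fderiv_eq_addHaar_image (volume : Measure E3) hO'm
    (fun z hz ↦ (hTd z (hO'O hz)).hasFDerivWithinAt) (hTinj.mono hO'O)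
  -- the image lies in the ball of radius `R'` …
  have himg : T '' O' ⊆ ball (0 : E3) R' := by
    rintro _ ⟨z, hz, rfl⟩
    obtain ⟨u, hu, hux⟩ := hsub (hmemfar z (hO'O hz))
    rw [mem_ball_zero_iff]
    have : T z = (Φ u : E3) := by
      show Ψ (e.dataChartExt z) = _
      rw [← hux, hΨU]
    rw [this]
    exact hu
  have hfin : volume (T '' O') < ⊤ := (measure_mono himg).trans_lt measure_ball_lt_top
  -- … but the Jacobian integral over `O'` is infinite
  have hvol : volume O' = ⊤ := by
    apply eq_top_iff.2
    rw [← volume_compl_closedBall_eq_top (max R₁ R₃)]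
    refine measure_mono fun z hz ↦ ?_
    have hz' : ¬ ‖z‖ ≤ max R₁ R₃ := by simpa [mem_closedBall, dist_zero_right] using hz
    exact not_le.1 hz'
  have hinf : ∫⁻ z in O', ENNReal.ofReal |(T' z).det| = ⊤ := by
    apply eq_top_iff.2
    calc (⊤ : ℝ≥0∞) = ENNReal.ofReal (1 / 128) * volume O' := by
          rw [hvol, ENNReal.mul_top (by positivity)]
      _ = ∫⁻ _ in O', ENNReal.ofReal (1 / 128) := by rw [setLIntegral_const]
      _ ≤ ∫⁻ z in O', ENNReal.ofReal |(T' z).det| :=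
          setLIntegral_mono' hO'm fun z hz ↦ ENNReal.ofReal_le_ofReal
            (hjac z (hO'O hz) ((le_max_right _ _).trans hz.le))
  rw [hcov] at hinf
  exact absurd hinf hfin.ne

/-- **Every far region of `e` eventually lies beyond any coordinate sphere of `Φ`**: under the
hypotheses of `not_far_subset_normLt`, with `U` an exterior region of `e`, for every `R'` there is
`R₁ > R` with `e.far R₁ ⊆ {R' < ‖Φ‖}`. (The compact set `{‖Φ‖ = ρ}` misses some far region
`e.far R₁`, which is preconnected and so lies in `{ρ < ‖Φ‖}` or in `{‖Φ‖ < ρ}`; the latter is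
excluded by `not_far_subset_normLt`.) [cite: Bartnik1986, §3] -/
theorem exists_far_subset_normGt [T2Space X] (ha : 0 < a) {α : ℝ} (hα : 0 < α)
    (hAF : e.IsMetricAsymptoticallyFlat D α) (hU : IsExteriorRegion e U)
    (hΦ : ∀ x : U, pullbackBilin (I := 𝓡 3) (I' := 𝓡 3) Φ
      (fun y ↦ (1 + a / ‖(y : E3)‖) ^ 4 • (innerSL ℝ (E := E3) : E3 →L[ℝ] E3 →L[ℝ] ℝ)) x =
        D.metric.val x.1)
    (R' : ℝ) :
    ∃ R₁, e.R < R₁ ∧ e.far R₁ ⊆ ((↑) : U → X) '' (Φ ⁻¹' {y | R' < ‖(y : E3)‖}) := by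
  obtain ⟨-, R₀, -, hfarU, -⟩ := id hU
  set ρ : ℝ := max R' a + 1 with hρ
  have hρa : a < ρ := by
    have := le_max_right R' a
    linarith
  have hρR : R' < ρ := by
    have := le_max_left R' a
    linarith
  -- the compact coordinate sphere `{‖Φ‖ = ρ}` misses a far region
  have hS : IsCompact (((↑) : U → X) '' (Φ ⁻¹' {y | (y : E3) ∈ sphere (0 : E3) ρ})) :=
    isCompact_val_image_preimage Φ (isCompact_sphere 0 ρ) fun z hz ↦ by
      rw [mem_sphere_zero_iff_norm] at hz
      show a < ‖z‖
      rw [hz]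
      exact hρa
  obtain ⟨R₁, hR₁, hdisj⟩ := e.exists_radius_far_disjoint hS
  set R₂ := max R₁ R₀ with hR₂
  have hR₂e : e.R < R₂ := hR₁.trans_le (le_max_left _ _)
  have hfar₂U : e.far R₂ ⊆ (U : Set X) := (e.far_mono (le_max_right _ _)).trans hfarU
  refine ⟨R₂, hR₂e, ?_⟩
  -- `far R₂ ⊆ {ρ < ‖Φ‖} ∪ {‖Φ‖ < ρ}`
  set A := ((↑) : U → X) '' (Φ ⁻¹' {y | ρ < ‖(y : E3)‖}) with hA
  set B := ((↑) : U → X) '' (Φ ⁻¹' {y | ‖(y : E3)‖ < ρ}) with hB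
  have hAB : e.far R₂ ⊆ A ∪ B := by
    intro x hx
    have hxU := hfar₂U hx
    have hxS : x ∉ ((↑) : U → X) '' (Φ ⁻¹' {y | (y : E3) ∈ sphere (0 : E3) ρ}) := fun h ↦
      (Set.disjoint_left.1 (hdisj R₂ (le_max_left _ _))) hx h
    rcases lt_trichotomy ‖(Φ ⟨x, hxU⟩ : E3)‖ ρ with hlt | heq | hgt
    · exact Or.inr ⟨⟨x, hxU⟩, hlt, rfl⟩
    · exact absurd ⟨⟨x, hxU⟩, mem_sphere_zero_iff_norm.2 heq, rfl⟩ hxS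
    · exact Or.inl ⟨⟨x, hxU⟩, hgt, rfl⟩
  have hdj : Disjoint A B := by
    rw [Set.disjoint_left]
    rintro _ ⟨u, hu, rfl⟩ ⟨u', hu', hu'u⟩
    have : u' = u := Subtype.ext hu'u
    subst this
    have hu1 : ρ < ‖(Φ u' : E3)‖ := hu
    have hu2 : ‖(Φ u' : E3)‖ < ρ := hu'
    exact lt_asymm hu1 hu2
  rcases (e.isPreconnected_far hR₂e.le).subset_or_subset (isOpen_val_image_preimage_normGt Φ ρ)
    (isOpen_val_image_preimage_normLt Φ ρ) hdj hAB with h1 | h2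
  · refine h1.trans ?_
    rintro _ ⟨u, hu, rfl⟩
    exact ⟨u, hρR.trans hu, rfl⟩
  · exact absurd h2 (not_far_subset_normLt Φ ha hα hAF hΦ hR₂e hfar₂U ρ)

/-- **Conversely, `{R₂ < ‖Φ‖}` eventually lies in any far region of `e`**: under the same
hypotheses, for every `R₁` there is `R₂` with `{R₂ < ‖Φ‖} ⊆ e.far R₁`. (For `R₁ > R`, the set
`{R₂ < ‖Φ‖}` is preconnected, misses the compact coordinate sphere `{‖coord‖ = R₁}` for `R₂`
large, hence lies in `far R₁` or in `U ∖ {R₁ ≤ ‖coord‖}`; the latter would contain a far region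
of `e` by `exists_far_subset_normGt`, which is absurd.) [cite: Bartnik1986, §3] -/
theorem exists_normGt_subset_far [T2Space X] (ha : 0 < a) {α : ℝ} (hα : 0 < α)
    (hAF : e.IsMetricAsymptoticallyFlat D α) (hU : IsExteriorRegion e U)
    (hΦ : ∀ x : U, pullbackBilin (I := 𝓡 3) (I' := 𝓡 3) Φ
      (fun y ↦ (1 + a / ‖(y : E3)‖) ^ 4 • (innerSL ℝ (E := E3) : E3 →L[ℝ] E3 →L[ℝ] ℝ)) x =
        D.metric.val x.1)
    (R₁ : ℝ) :
    ∃ R₂, ((↑) : U → X) '' (Φ ⁻¹' {y | R₂ < ‖(y : E3)‖}) ⊆ e.far R₁ := by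
  obtain ⟨-, R₀, hR₀, hfarU, -⟩ := id hU
  -- enlarge `R₁` beyond `R₀`
  set R₁' : ℝ := max R₁ (R₀ + 1) with hR₁'
  have hR₁'0 : R₀ < R₁' := by
    have := le_max_right R₁ (R₀ + 1)
    linarith
  have hR₁'e : e.R < R₁' := hR₀.trans hR₁'0
  suffices h : ∃ R₂, ((↑) : U → X) '' (Φ ⁻¹' {y | R₂ < ‖(y : E3)‖}) ⊆ e.far R₁' by
    obtain ⟨R₂, hR₂⟩ := h
    exact ⟨R₂, hR₂.trans (e.far_mono (le_max_left _ _))⟩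
  -- the closed far piece `C = {R₁' ≤ ‖coord‖}` and the coordinate sphere `S₁ = {‖coord‖ = R₁'}`
  set C : Set X := ((↑) : e.U → X) '' (e.chart ⁻¹' {z | R₁' ≤ ‖(z : E3)‖}) with hC
  have hCc : IsClosed C := e.isClosed_far R₁' hR₁'e
  set S₁ : Set X := e.dataChart '' {y : exteriorRegion e.R | ‖(y : E3)‖ = R₁'} with hS₁
  have hS₁c : IsCompact S₁ := by
    refine IsCompact.image ?_ e.contMDiff_dataChart.continuous
    have hsph : Subtype.val '' {y : exteriorRegion e.R | ‖(y : E3)‖ = R₁'} =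
        sphere (0 : E3) R₁' := by
      ext z
      rw [mem_sphere_zero_iff_norm]
      constructor
      · rintro ⟨y, hy, rfl⟩
        exact hy
      · intro hz
        exact ⟨⟨z, mem_exteriorRegion.2 (by rw [hz]; exact hR₁'e)⟩, hz, rfl⟩
    have h := isCompact_sphere (0 : E3) R₁'
    rw [← hsph, ← Topology.IsEmbedding.subtypeVal.isCompact_iff] at h
    exact h
  have hS₁U : S₁ ⊆ (U : Set X) := by
    rintro _ ⟨y, hy, rfl⟩
    refine hfarU (e.mem_far_iff.2 ⟨y, ?_, rfl⟩)
    rw [show ‖(y : E3)‖ = R₁' from hy]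
    exact hR₁'0
  -- `Φ` is bounded on `S₁`
  obtain ⟨R₂, hR₂⟩ : ∃ R₂ : ℝ, ∀ u : U, (u : X) ∈ S₁ → ‖(Φ u : E3)‖ ≤ R₂ := by
    have hK : IsCompact ((fun u : U ↦ (Φ u : E3)) '' {u : U | (u : X) ∈ S₁}) := by
      refine IsCompact.image ?_ (continuous_subtype_val.comp Φ.continuous)
      have himg : Subtype.val '' {u : U | (u : X) ∈ S₁} = S₁ := by
        ext x
        constructor
        · rintro ⟨u, hu, rfl⟩
          exact hu
        · intro hx
          exact ⟨⟨x, hS₁U hx⟩, hx, rfl⟩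
      have h := hS₁c
      rw [← himg, ← Topology.IsEmbedding.subtypeVal.isCompact_iff] at h
      exact h
    obtain ⟨R₂, hR₂⟩ := hK.isBounded.subset_closedBall 0
    refine ⟨R₂, fun u hu ↦ ?_⟩
    have := hR₂ ⟨u, hu, rfl⟩
    rwa [mem_closedBall, dist_zero_right] at this
  set R₂' : ℝ := max R₂ a with hR₂'
  refine ⟨R₂', ?_⟩
  set A : Set X := ((↑) : U → X) '' (Φ ⁻¹' {y | R₂' < ‖(y : E3)‖}) with hA
  -- `A ⊆ far R₁' ∪ (U ∖ C)`
  have hcover : A ⊆ e.far R₁' ∪ ((U : Set X) ∩ Cᶜ) := by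
    rintro _ ⟨u, hu, rfl⟩
    by_cases huC : (u : X) ∈ C
    · left
      obtain ⟨huU', h2⟩ := e.mem_image_preimage_le_norm_iff.1 huC
      rcases h2.lt_or_eq with hlt | heq
      · exact e.mem_far_iff_coord.2 ⟨huU', hlt⟩
      · exfalso
        have huS : (u : X) ∈ S₁ :=
          ⟨⟨e.coord u, e.lt_norm_coord huU'⟩, heq.symm, e.dataChart_coord huU'⟩
        have h3 := hR₂ u huS
        have h4 : R₂' < ‖(Φ u : E3)‖ := hu
        exact absurd ((le_max_left R₂ a).trans_lt h4) (not_lt.2 h3)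
    · right
      exact ⟨u.2, huC⟩
  have hdj : Disjoint (e.far R₁') ((U : Set X) ∩ Cᶜ) :=
    Set.disjoint_left.2 fun x hx hx' ↦ hx'.2 (e.closure_far_subset hR₁'e (subset_closure hx))
  have hopen2 : IsOpen ((U : Set X) ∩ Cᶜ) := U.isOpen.inter hCc.isOpen_compl
  rcases (isPreconnected_val_image_preimage_normGt Φ ha (le_max_right _ _)).subset_or_subset
    (e.isOpen_far _) hopen2 hdj hcover with h1 | h2
  · exact h1
  · exfalso
    obtain ⟨R₃, -, hfar₃⟩ := exists_far_subset_normGt Φ ha hα hAF hU hΦ R₂'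
    -- a point of `far (max R₃ R₁')` (far regions are nonempty)
    obtain ⟨x, hx⟩ : (e.far (max R₃ R₁')).Nonempty := by
      set r : ℝ := max (max R₃ R₁') e.R + 1 with hr
      have hr0 : 0 ≤ r := by
        have := le_max_right (max R₃ R₁') e.R
        linarith [e.R_pos]
      set z : E3 := r • EuclideanSpace.single (0 : Fin 3) (1 : ℝ) with hz
      have hzn : ‖z‖ = r := by
        rw [hz, norm_smul, Real.norm_of_nonneg hr0]
        simp
      have hzR : e.R < ‖z‖ := by
        rw [hzn, hr]
        linarith [le_max_right (max R₃ R₁') e.R]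
      refine ⟨e.dataChart ⟨z, hzR⟩, e.mem_far_iff.2 ⟨⟨z, hzR⟩, ?_, rfl⟩⟩
      show max R₃ R₁' < ‖z‖
      rw [hzn, hr]
      linarith [le_max_left (max R₃ R₁') e.R]
    have hx₃ : x ∈ e.far R₃ := e.far_mono (le_max_left _ _) hx
    have hx₁ : x ∈ e.far R₁' := e.far_mono (le_max_right _ _) hx
    exact (h2 (hfar₃ hx₃)).2 (e.closure_far_subset hR₁'e (subset_closure hx₁))

/-- **`{R' ≤ ‖Φ‖}` is closed in `X` for `R' > a`** (the end structure `Φ` is closed at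
infinity): it is the union of the compact piece `{R' ≤ ‖Φ‖ ≤ ρ}` and, for `ρ` large, of a piece
`{ρ ≤ ‖Φ‖}` contained in a far region of `e` whose closure lies inside `U`, and which is closed
in `U`. [cite: Bartnik1986, §3] -/
theorem isClosed_val_image_preimage_normGe [T2Space X] (ha : 0 < a) {α : ℝ} (hα : 0 < α)
    (hAF : e.IsMetricAsymptoticallyFlat D α) (hU : IsExteriorRegion e U)
    (hΦ : ∀ x : U, pullbackBilin (I := 𝓡 3) (I' := 𝓡 3) Φ
      (fun y ↦ (1 + a / ‖(y : E3)‖) ^ 4 • (innerSL ℝ (E := E3) : E3 →L[ℝ] E3 →L[ℝ] ℝ)) x =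
        D.metric.val x.1)
    {R' : ℝ} (hR' : a < R') :
    IsClosed (((↑) : U → X) '' (Φ ⁻¹' {y | R' ≤ ‖(y : E3)‖})) := by
  obtain ⟨-, R₀, hR₀, hfarU, -⟩ := id hU
  obtain ⟨R₂, hR₂⟩ := exists_normGt_subset_far Φ ha hα hAF hU hΦ (R₀ + 1)
  set ρ : ℝ := max R₂ R' + 1 with hρ
  have hρ₂ : R₂ < ρ := by
    have := le_max_left R₂ R'
    linarith
  set F₁ : Set X := ((↑) : U → X) '' (Φ ⁻¹' {y | (y : E3) ∈ {z : E3 | R' ≤ ‖z‖ ∧ ‖z‖ ≤ ρ}})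
    with hF₁
  set F₂ : Set X := ((↑) : U → X) '' (Φ ⁻¹' {y | ρ ≤ ‖(y : E3)‖}) with hF₂
  have hF : ((↑) : U → X) '' (Φ ⁻¹' {y | R' ≤ ‖(y : E3)‖}) = F₁ ∪ F₂ := by
    ext x
    constructor
    · rintro ⟨u, hu, rfl⟩
      by_cases h : ‖(Φ u : E3)‖ ≤ ρ
      · exact Or.inl ⟨u, ⟨hu, h⟩, rfl⟩
      · exact Or.inr ⟨u, (not_le.1 h).le, rfl⟩
    · rintro (⟨u, hu, rfl⟩ | ⟨u, hu, rfl⟩)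
      · exact ⟨u, hu.1, rfl⟩
      · refine ⟨u, ?_, rfl⟩
        show R' ≤ ‖(Φ u : E3)‖
        have : R' ≤ ρ := by
          have := le_max_right R₂ R'
          linarith
        exact this.trans hu
  -- `F₁` is compact
  have hF₁c : IsClosed F₁ := by
    refine (isCompact_val_image_preimage Φ ?_ fun z hz ↦ hR'.trans_le hz.1).isClosed
    exact (isCompact_closedBall (0 : E3) ρ).of_isClosed_subset
      ((isClosed_le continuous_const continuous_norm).inter
        (isClosed_le continuous_norm continuous_const))
      fun z hz ↦ mem_closedBall_zero_iff.2 hz.2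
  -- `F₂` lies in a far region whose closure is inside `U`, and is closed in `U`
  have hF₂far : F₂ ⊆ e.far (R₀ + 1) := by
    rintro _ ⟨u, hu, rfl⟩
    exact hR₂ ⟨u, hρ₂.trans_le hu, rfl⟩
  have hcl : closure F₂ ⊆ (U : Set X) :=
    (closure_mono hF₂far).trans (((e.closure_far_subset (by linarith)).trans
      (e.image_preimage_normGe_subset_far (lt_add_one R₀))).trans hfarU)
  have hF₂c : IsClosed F₂ := by
    refine closure_subset_iff_isClosed.1 fun x hx ↦ ?_
    have hxU : x ∈ (U : Set X) := hcl hx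
    have hx' : (⟨x, hxU⟩ : U) ∈ closure (Φ ⁻¹' {y : exteriorRegion a | ρ ≤ ‖(y : E3)‖}) := by
      rw [closure_subtype]
      exact hx
    rw [((isClosed_le continuous_const continuous_subtype_val.norm).preimage
      Φ.continuous).closure_eq] at hx'
    exact ⟨⟨x, hxU⟩, hx', rfl⟩
  rw [hF]
  exact hF₁c.union hF₂c

/-- **An exterior region isometric to the Schwarzschild exterior is an end structure of the
same end.** Let `U` be an exterior region of the end `e` of the `3`-manifold `(X, h)`, `e`
asymptotically flat of some order `α > 0` in the metric, and let
`Φ : U ≅ {a < ‖y‖}` (`a > 0`) be a diffeomorphism with `Φ^* ((1 + a/‖y‖)⁴ δ) = h` on `U` — the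
conclusion of `Bray2001_penrose_rigidity_exteriorRegion` / `Bray2001_capacity_rigidity` with
`a = m/2`. Then there is an end structure `e'` of `X` with `e'.U = U`, inner radius `a`, chart
`Φ`, describing the same end as `e` (`IsSameEnd e e'`: the far regions of the two structures are
cofinal in each other), in whose chart `h` has the Schwarzschild components
`h_{ij}(z) = (1 + a/‖z‖)⁴ δ_{ij}`. Bartnik 1986, §3 (two structures of infinity of the same
end); Bray 2001, §1 (12). [cite: Bartnik1986, §3] [cite: BrayRPI2001, §1 (12)] -/
theorem exists_afEnd_isSameEnd [T2Space X] (ha : 0 < a) {α : ℝ} (hα : 0 < α)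
    (hAF : e.IsMetricAsymptoticallyFlat D α) (hU : IsExteriorRegion e U)
    (hΦ : ∀ x : U, pullbackBilin (I := 𝓡 3) (I' := 𝓡 3) Φ
      (fun y ↦ (1 + a / ‖(y : E3)‖) ^ 4 • (innerSL ℝ (E := E3) : E3 →L[ℝ] E3 →L[ℝ] ℝ)) x =
        D.metric.val x.1) :
    ∃ e' : AFEnd X, e'.U = U ∧ e'.R = a ∧ AFEnd.IsSameEnd e e' ∧
      ∀ z : E3, e'.R < ‖z‖ → ∀ i j : Fin 3,
        AFEnd.hCoeff e' D z (EuclideanSpace.single i 1) (EuclideanSpace.single j 1) =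
          (1 + e'.R / ‖z‖) ^ 4 * (if i = j then 1 else 0) := by
  let e' : AFEnd X :=
    ⟨U, a, ha, Φ, fun R' hR' ↦ isClosed_val_image_preimage_normGe Φ ha hα hAF hU hΦ hR'⟩
  refine ⟨e', rfl, rfl, ⟨fun R₂ ↦ ?_, fun R₂ ↦ ?_⟩, ?_⟩
  · obtain ⟨R₁, -, h⟩ := exists_far_subset_normGt Φ ha hα hAF hU hΦ R₂
    exact ⟨R₁, h⟩
  · exact exists_normGt_subset_far Φ ha hα hAF hU hΦ R₂
  · intro z hz i j
    have hz' : a < ‖z‖ := hz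
    set y : exteriorRegion a := ⟨z, mem_exteriorRegion.2 hz'⟩ with hy
    have hΦx : Φ (Φ.symm y) = y := Φ.apply_symm_apply y
    have hsd : MDifferentiableAt (𝓡 3) (𝓡 3) Φ.symm y :=
      Φ.symm.contMDiff.mdifferentiableAt (by simp)
    have hd : MDifferentiableAt (𝓡 3) (𝓡 3) Φ (Φ.symm y) :=
      Φ.contMDiff.mdifferentiableAt (by simp)
    -- `dΦ ∘ dΦ⁻¹ = id`
    have hid : ∀ v : E3,
        mfderiv (𝓡 3) (𝓡 3) Φ (Φ.symm y) (mfderiv (𝓡 3) (𝓡 3) Φ.symm y v) = v := by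
      intro v
      have h1 : mfderiv (𝓡 3) (𝓡 3) (Φ ∘ Φ.symm) y =
          (mfderiv (𝓡 3) (𝓡 3) Φ (Φ.symm y)).comp (mfderiv (𝓡 3) (𝓡 3) Φ.symm y) :=
        mfderiv_comp y hd hsd
      have h2 : ((Φ ∘ Φ.symm) : exteriorRegion a → exteriorRegion a) = id :=
        funext fun w ↦ Φ.apply_symm_apply w
      rw [h2, mfderiv_id] at h1
      exact DFunLike.congr_fun h1.symm v
    -- the differential of the inverse chart `val ∘ Φ⁻¹`
    have hdc : ∀ v : E3, mfderiv (𝓡 3) (𝓡 3) e'.dataChart y v =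
        mfderiv (𝓡 3) (𝓡 3) Φ.symm y v := by
      intro v
      show mfderiv (𝓡 3) (𝓡 3) ((Subtype.val : U → X) ∘ Φ.symm) y v = _
      rw [mfderiv_comp y (hasMFDerivAt_subtypeVal (Φ.symm y)).mdifferentiableAt hsd,
        mfderiv_subtypeVal]
      rfl
    -- the metric at `Φ⁻¹ y` through `Φ`
    have hmet : ∀ v' w' : E3, D.h.inner ((Φ.symm y : U) : X) v' w' =
        (1 + a / ‖(Φ (Φ.symm y) : E3)‖) ^ 4 *
          @inner ℝ E3 _ (mfderiv (𝓡 3) (𝓡 3) Φ (Φ.symm y) v')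
            (mfderiv (𝓡 3) (𝓡 3) Φ (Φ.symm y) w') := by
      intro v' w'
      have h := DFunLike.congr_fun (DFunLike.congr_fun (hΦ (Φ.symm y)) v') w'
      exact h.symm
    rw [AFEnd.hCoeff_of_lt D (show e'.R < ‖z‖ from hz)]
    show D.h.inner ((Φ.symm y : U) : X)
      (mfderiv (𝓡 3) (𝓡 3) e'.dataChart y (EuclideanSpace.single i 1))
      (mfderiv (𝓡 3) (𝓡 3) e'.dataChart y (EuclideanSpace.single j 1)) =
      (1 + a / ‖z‖) ^ 4 * (if i = j then 1 else 0)
    rw [hdc, hdc, hmet, hid, hid, hΦx,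
      ← orthonormal_iff_ite.1 (EuclideanSpace.orthonormal_single (𝕜 := ℝ) (ι := Fin 3)) i j]

/-! ### The capacity of the horizon of an exterior region isometric to the Schwarzschild exterior -/

/-- **`ℰ(∂U, h) = 2m` for an exterior region isometric to the Schwarzschild exterior of mass
`m = 2a`.** Let `U` be an exterior region of the end `e` of the `3`-manifold `(X, h)`, `e`
asymptotically flat of some order `α > 0` in the metric, and `Φ : U ≅ {a < ‖y‖}` (`a > 0`) a
diffeomorphism with `Φ^* ((1 + a/‖y‖)⁴ δ) = h` on `U`. Then the capacity of Def. 17 of the horizon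
`∂U` with outside `U`, read in the end `e`, is `horizonCapacity D.h e U = ENNReal.ofReal (4a)`
(`= 2m`): by `exists_afEnd_isSameEnd`, `Φ` is an end structure `e'` of the same end with
Schwarzschild chart components, the capacity does not depend on the structure
(`AFEnd.IsSameEnd.horizonCapacity_eq`), `U` is an exterior region of `e'`
(`AFEnd.IsSameEnd.isExteriorRegion`), and `AFEnd.horizonCapacity_eq_of_hCoeff_eq_schwarzschild`
applies. Bray, J. Differential Geom. 59 (2001), Thm. 9, case of equality (Schwarzschild outside
`Σ` ⇒ `ℰ(Σ, g) = 2m`), for the conclusion of Thm. 19 (case of equality).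
[cite: BrayRPI2001, §6 Thm. 9 (case of equality) with Def. 17 and §13 Thm. 19] -/
theorem horizonCapacity_eq_of_diffeomorph_schwarzschild [T2Space X] [LocallyCompactSpace X]
    [SigmaCompactSpace X] [MeasurableSpace X] [BorelSpace X] [D.metric.HasLeviCivita]
    (ha : 0 < a) {α : ℝ} (hα : 0 < α) (hAF : e.IsMetricAsymptoticallyFlat D α)
    (hU : IsExteriorRegion e U)
    (hΦ : ∀ x : U, pullbackBilin (I := 𝓡 3) (I' := 𝓡 3) Φ
      (fun y ↦ (1 + a / ‖(y : E3)‖) ^ 4 • (innerSL ℝ (E := E3) : E3 →L[ℝ] E3 →L[ℝ] ℝ)) x =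
        D.metric.val x.1) :
    horizonCapacity D.h e U = ENNReal.ofReal (4 * a) := by
  obtain ⟨e', hU', hR', hsame, hc⟩ := exists_afEnd_isSameEnd Φ ha hα hAF hU hΦ
  rw [hsame.horizonCapacity_eq D.h U]
  have hU'' : IsExteriorRegion e' e'.U := by
    rw [hU']
    exact hsame.isExteriorRegion hU
  have h := e'.horizonCapacity_eq_of_hCoeff_eq_schwarzschild D hU'' hc
  rw [hU', hR'] at h
  exact h

/-- **`ℰ(∂U, h)/2 = m`** for an exterior region isometric to the Schwarzschild exterior of mass
`m = 2a`: the conclusion `(horizonCapacity …).toReal / 2 = m` of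
`Bray2001_capacity_eq_of_penrose_eq` from the conclusion of
`Bray2001_penrose_rigidity_exteriorRegion`. Bray 2001, Thm. 9 (case of equality) with Thm. 19.
[cite: BrayRPI2001, §6 Thm. 9 (case of equality) and §13 Thm. 19] -/
theorem horizonCapacity_toReal_div_two_eq_of_diffeomorph_schwarzschild [T2Space X]
    [LocallyCompactSpace X] [SigmaCompactSpace X] [MeasurableSpace X] [BorelSpace X]
    [D.metric.HasLeviCivita] (ha : 0 < a) {α : ℝ} (hα : 0 < α)
    (hAF : e.IsMetricAsymptoticallyFlat D α) (hU : IsExteriorRegion e U)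
    (hΦ : ∀ x : U, pullbackBilin (I := 𝓡 3) (I' := 𝓡 3) Φ
      (fun y ↦ (1 + a / ‖(y : E3)‖) ^ 4 • (innerSL ℝ (E := E3) : E3 →L[ℝ] E3 →L[ℝ] ℝ)) x =
        D.metric.val x.1) :
    (horizonCapacity D.h e U).toReal / 2 = 2 * a := by
  rw [horizonCapacity_eq_of_diffeomorph_schwarzschild Φ ha hα hAF hU hΦ,
    ENNReal.toReal_ofReal (by positivity)]
  ring

end Isometry

end Literature.Geometry.Lorentzian

end
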